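import Summits.CriticalPhenomena.PercolationContinuityZ3.Theorems.PercNearOneGluingNoHeavyLowerTailAntitheticBlockTools
import HarnessLib

/-!
# `NoHeavyLowerTail` (stmt-CriticalPhenomena-4575) — antithetic cluster pairs: the CUT-VERTEX (BLOCK-GLUING) THEOREM — CONJECTURE BIC reduces to
# 2-connected graphs (prim-hp-2 gen 39; HOME/MEMO-gen39-pendant.md §2)

Support file (`--supports stmt-CriticalPhenomena-4575`, hull-port prover `prim-hp-2`, gen 39).  No definitions, no named facts, no sorries; standard
axioms.

SETTING as in …AntitheticBlockTools: `E₁, E₂` glued at one vertex `a`, source `s` on the `E₁` side (`s = a` allowed), `E₁ ∩ E₂ = ∅`;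
`T_E(R,X)` the constrained antithetic sum (`Peel.tsum`), "good" = `T ≥ 0` for all increasing `F, G`.
* `Antithetic.Glue.tsum_union_nonneg` — **THEOREM (block gluing).**  If `(E₁, s)` is good for `(R, X)` and for `(R ∪ {a}, X)`, and `(E₂, a)` is good
  for `(R ∖ {a}, ∅)`, then `(E₁ ∪ E₂, s)` is good for `(R, X)` (sinks `X` on the `E₁` side).  Consequently CONJECTURE BIC (`BIC_E(R) ≥ 0` for all
  `E, s, R`) holds for every graph as soon as it holds for every 2-connected graph (every block, every source, every `R`); the pendant-edge lemma
  (…AntitheticPendant) is the case `E₂ = {aℓ}`, and all "hanging / product / petal" theorems of the programme are instances.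
PROOF (MEMO-gen39 §2).  Write `x, y` for the red/blue clusters of `s` in the colouring of `E₁`, `A, B` for those of `a` in the colouring of `E₂`,
`ρ(C) = [a = s ∨ a ∈ ⋃ C]`, `C ⊕ S = C ∪ S` if `ρ(C)` else `C` (`Glue.lift`).  The clusters of `s` in `E₁ ∪ E₂` are `(x ⊕ A, y ⊕ B)`
(`Glue.openEdgeCluster_union`), and reflecting the colours of `E₂` gives `(x ⊕ B, y ⊕ A)`; the constraint set is
`tset₁(R) ∧ (a ∈ W∩W' → tset₂(R∖a))` and is reflection invariant.  With `p = F(x⊕A), r = F(x⊕B), t = F(y⊕A), q = F(y⊕B)`: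
`(p−q)(p'−q') + (r−t)(r'−t') = ½((p+r)−(t+q))((p'+r')−(t'+q')) + ½((p−r)+(t−q))((p'−r')+(t'−q'))`; the first term is the `E₁`-functional of
`Φ = F(·⊕A) + F(·⊕B)` (increasing), the second expands into four `E₂`-functionals `(u(A)−u(B))(v(A)−v(B))` of the increasing set functions
`u = F(x ⊕ ·), F(y ⊕ ·)`, `v = G(x ⊕ ·), G(y ⊕ ·)`.  Summing over the fibres `{ω ∩ E₂ = θ}` resp. `{ω ∩ E₁ = η}` (`Glue.fiber_nonneg`) gives
`2·T_{E₁∪E₂}(R,X) = ½ Σ_θ T_{E₁}(R or R∪a, X; Φ_θ, Ψ_θ)/2^{|E₂|} + ½ Σ_η Σ_{u,v} T_{E₂}(R∖a or ∅, ∅; u, v)/2^{|E₁|} ≥ 0` (the case is `R` if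
`θ ∈ tset₂(R∖a)` else `R ∪ a`; `R∖a` if `a ∈ W∩W'(η)` else `∅`, where Harris suffices).  Exact identity checked numerically in
HOME/code/gen39/lab39/cutvertex_check.py.
[cite: VandenbergHaggstromKahn2005, §1 p. 3 (open cluster `C_s`), §1 p. 6 ("Harris' inequality")]
-/

noncomputable section

namespace Summit.CriticalPhenomena.PercolationContinuityZ3.Theorems

open Literature.Probability.Percolation
open scoped Classical symmDiff

namespace Antithetic

namespace Glue

variable {V : Type*} [Fintype V] {E₁ E₂ : Set (Sym2 V)} {s a : V}

/-- The pure algebra of the block-gluing theorem. [this work] -/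
theorem glue_identity (p q r t p' q' r' t' : ℝ) :
    (p - q) * (p' - q') + (r - t) * (r' - t') =
      (1 / 2 : ℝ) * (((p + r) - (t + q)) * ((p' + r') - (t' + q'))) +
        (1 / 2 : ℝ) * (((p - r) * (p' - r') + (p - r) * (t' - q')) + ((t - q) * (p' - r') + (t - q) * (t' - q'))) := by
  ring

/-- The constraint set of `E₁ ∪ E₂`: the `E₁`-constraints, and the `E₂`-constraints (source `a`, avoidance `R ∖ {a}`) whenever `a` is joined to `s`
in both colours of `E₁`. [this work] -/
theorem mem_tset_union (hsep : ∀ e₁ ∈ E₁, ∀ e₂ ∈ E₂, ∀ v : V, v ∈ e₁ → v ∈ e₂ → v = a) (hs : ∀ e ∈ E₂, s ∈ e → s = a)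
    (R X : Set V) (hX : ∀ x ∈ X, ∀ e ∈ E₂, x ∈ e → x = a) (ω : Set (Sym2 V)) :
    ω ∈ Peel.tset (E₁ ∪ E₂) s R X ↔ ω ∈ Peel.tset E₁ s R X ∧
      (((openGraph (ω ∩ E₁)).Reachable s a ∧ (openGraph (ωᶜ ∩ E₁)).Reachable s a) → ω ∈ Peel.tset E₂ a (R \ {a}) ∅) := by
  simp only [Peel.mem_tset, Set.mem_empty_iff_false, false_implies, implies_true, and_true, Set.mem_sdiff, Set.mem_singleton_iff]
  -- dichotomy of vertices: meeting `E₂` away from `a` ("side two") or not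
  have two : ∀ v, (∃ e ∈ E₂, v ∈ e ∧ v ≠ a) ∨ (∀ e ∈ E₂, v ∈ e → v = a) := fun v => by
    by_cases h : ∃ e ∈ E₂, v ∈ e ∧ v ≠ a
    · exact Or.inl h
    · push Not at h; exact Or.inr h
  have iso₁ : ∀ v, (∃ e ∈ E₂, v ∈ e ∧ v ≠ a) → ∀ η : Set (Sym2 V), (openGraph (η ∩ E₁)).Reachable s v → False := by
    rintro v ⟨e, he, hve, hva⟩ η h
    have hsv : s ≠ v := fun h' => hva (h' ▸ hs e he (h' ▸ hve))
    obtain ⟨w, hw, -⟩ := exists_pair_of_reachable (η ∩ E₁) (Ne.symm hsv) h.symm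
    exact hva (hsep _ hw.2 e he v (Sym2.mem_mk_left _ _) hve)
  have iso₂ : ∀ v, (∀ e ∈ E₂, v ∈ e → v = a) → v ≠ a → ∀ η : Set (Sym2 V), (openGraph (η ∩ E₂)).Reachable a v → False := by
    intro v hv hva η h
    obtain ⟨w, hw, -⟩ := exists_pair_of_reachable (η ∩ E₂) hva h.symm
    exact hva (hv _ hw.2 (Sym2.mem_mk_left v w))
  have hc₁ : ωᶜ ∩ (E₁ ∪ E₂) = ωᶜ ∩ (E₁ ∪ E₂) := rfl
  constructor
  · rintro ⟨hR, hX'⟩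
    refine ⟨⟨fun r hr => ?_, fun x hx => ?_⟩, fun hd r ⟨hr, hra⟩ hboth => ?_⟩
    · rcases two r with h2 | h1
      · exact fun h => iso₁ r h2 ω h.1
      · rw [← reach_side_one s hsep hs h1, ← reach_side_one (ω := ωᶜ) s hsep hs h1]; exact hR r hr
    · rw [← reach_side_one s hsep hs (hX x hx), ← reach_side_one (ω := ωᶜ) s hsep hs (hX x hx)]; exact hX' x hx
    · rcases two r with ⟨e, he, hre, -⟩ | h1
      · exact hR r hr ⟨(reach_side_two s hsep hs hra he hre).2 ⟨hd.1, hboth.1⟩,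
          (reach_side_two (ω := ωᶜ) s hsep hs hra he hre).2 ⟨hd.2, hboth.2⟩⟩
      · exact iso₂ r h1 hra ω hboth.1
  · rintro ⟨⟨hR, hX'⟩, himp⟩
    refine ⟨fun r hr hboth => ?_, fun x hx => ?_⟩
    · rcases two r with ⟨e, he, hre, hra⟩ | h1
      · obtain ⟨ha, h2⟩ := (reach_side_two s hsep hs hra he hre).1 hboth.1
        obtain ⟨ha', h2'⟩ := (reach_side_two (ω := ωᶜ) s hsep hs hra he hre).1 hboth.2
        exact himp ⟨ha, ha'⟩ r ⟨hr, hra⟩ ⟨h2, h2'⟩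
      · rw [reach_side_one s hsep hs h1, reach_side_one (ω := ωᶜ) s hsep hs h1] at hboth; exact hR r hr hboth
    · rw [reach_side_one s hsep hs (hX x hx), reach_side_one (ω := ωᶜ) s hsep hs (hX x hx)]; exact hX' x hx

omit [Fintype V] in
/-- `a` is not joined to `s` in both colours of `E₁` iff the extra avoidance constraint at `a` holds. -/
theorem mem_tset_insert [Fintype V] (R X : Set V) (ω : Set (Sym2 V)) :
    ω ∈ Peel.tset E₁ s (insert a R) X ↔
      ω ∈ Peel.tset E₁ s R X ∧ ¬ ((openGraph (ω ∩ E₁)).Reachable s a ∧ (openGraph (ωᶜ ∩ E₁)).Reachable s a) := by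
  simp only [Peel.mem_tset, Set.mem_insert_iff, forall_eq_or_imp]
  tauto

/-- **THEOREM (block gluing at a cut vertex; prim-hp-2 gen 39).**  `E₁, E₂` edge sets on a finite vertex type meeting only at the vertex `a`
(`hsep`), disjoint, the source `s` on the `E₁` side (`hs`), sinks `X` on the `E₁` side (`hX`).  If `T_{E₁}(R, X) ≥ 0` and `T_{E₁}(R ∪ {a}, X) ≥ 0`
for all increasing `F, G` (source `s`) and `T_{E₂}(R ∖ {a}, ∅) ≥ 0` for all increasing `F, G` (source `a`), then `T_{E₁ ∪ E₂}(R, X) ≥ 0` for all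
increasing `F, G`.  In particular `BIC ≥ 0` for every graph follows from `BIC ≥ 0` for its blocks. [this work] -/
theorem tsum_union_nonneg (hsep : ∀ e₁ ∈ E₁, ∀ e₂ ∈ E₂, ∀ v : V, v ∈ e₁ → v ∈ e₂ → v = a) (hs : ∀ e ∈ E₂, s ∈ e → s = a)
    (hdis : ∀ e ∈ E₂, e ∉ E₁) (R X : Set V) (hX : ∀ x ∈ X, ∀ e ∈ E₂, x ∈ e → x = a)
    (h₁ : ∀ F G : Set (Sym2 V) → ℝ, Monotone F → Monotone G → 0 ≤ Peel.tsum F G E₁ s R X)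
    (h₁' : ∀ F G : Set (Sym2 V) → ℝ, Monotone F → Monotone G → 0 ≤ Peel.tsum F G E₁ s (insert a R) X)
    (h₂ : ∀ F G : Set (Sym2 V) → ℝ, Monotone F → Monotone G → 0 ≤ Peel.tsum F G E₂ a (R \ {a}) ∅)
    {F G : Set (Sym2 V) → ℝ} (hF : Monotone F) (hG : Monotone G) : 0 ≤ Peel.tsum F G (E₁ ∪ E₂) s R X := by
  have hdis' : ∀ e ∈ E₁, e ∉ E₂ := fun e he h => hdis e h he
  -- notation: traces and clusters
  let x₀ : Set (Sym2 V) → Set (Sym2 V) := fun ω => openEdgeCluster (ω ∩ E₁) s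
  let y₀ : Set (Sym2 V) → Set (Sym2 V) := fun ω => openEdgeCluster (ωᶜ ∩ E₁) s
  let A : Set (Sym2 V) → Set (Sym2 V) := fun ω => openEdgeCluster (ω ∩ E₂) a
  let B : Set (Sym2 V) → Set (Sym2 V) := fun ω => openEdgeCluster (ωᶜ ∩ E₂) a
  -- Harris for `E₂` with no constraints
  have h₂' : ∀ u v : Set (Sym2 V) → ℝ, Monotone u → Monotone v → 0 ≤ Peel.tsum u v E₂ a ∅ ∅ := by
    intro u v hu hv
    have hset : Peel.tset E₂ a ∅ ∅ = Finset.univ := by ext ω; simp [Peel.mem_tset]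
    unfold Peel.tsum Peel.delta; rw [hset]; exact antithetic_harris E₂ a hu hv
  -- (1) the clusters of `E₁ ∪ E₂` and of the reflected colouring `ω ∆ E₂`
  have hΔ : ∀ ω, Peel.delta F G (E₁ ∪ E₂) s ω =
      (F (lift s a (A ω) (x₀ ω)) - F (lift s a (B ω) (y₀ ω))) * (G (lift s a (A ω) (x₀ ω)) - G (lift s a (B ω) (y₀ ω))) := by
    intro ω; unfold Peel.delta
    rw [openEdgeCluster_union s ω hsep hs, openEdgeCluster_union s ωᶜ hsep hs]
  have hΔσ : ∀ ω, Peel.delta F G (E₁ ∪ E₂) s (ω ∆ E₂) =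
      (F (lift s a (B ω) (x₀ ω)) - F (lift s a (A ω) (y₀ ω))) * (G (lift s a (B ω) (x₀ ω)) - G (lift s a (A ω) (y₀ ω))) := by
    intro ω
    rw [hΔ]
    simp only [x₀, y₀, A, B, symmDiff_inter_eq E₁ ω hdis, compl_symmDiff_inter_eq E₁ ω hdis, symmDiff_self_inter_eq, compl_symmDiff_self_inter_eq]
  -- (2) the constraint set is reflection invariant
  have hmemσ : ∀ ω, ω ∆ E₂ ∈ Peel.tset (E₁ ∪ E₂) s R X ↔ ω ∈ Peel.tset (E₁ ∪ E₂) s R X := by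
    intro ω
    rw [mem_tset_union hsep hs R X hX, mem_tset_union hsep hs R X hX, mem_tset_congr E₁ s R X (symmDiff_inter_eq E₁ ω hdis)
      (compl_symmDiff_inter_eq E₁ ω hdis), symmDiff_inter_eq E₁ ω hdis, compl_symmDiff_inter_eq E₁ ω hdis,
      mem_tset_swap E₂ a (R \ {a}) (symmDiff_self_inter_eq E₂ ω) (compl_symmDiff_self_inter_eq E₂ ω)]
  have hrefl : ∑ ω ∈ Peel.tset (E₁ ∪ E₂) s R X, Peel.delta F G (E₁ ∪ E₂) s ω =
      ∑ ω ∈ Peel.tset (E₁ ∪ E₂) s R X, Peel.delta F G (E₁ ∪ E₂) s (ω ∆ E₂) :=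
    Finset.sum_nbij' (fun ω => ω ∆ E₂) (fun ω => ω ∆ E₂) (fun ω hω => (hmemσ ω).2 hω) (fun ω hω => (hmemσ ω).2 hω)
      (fun ω _ => symmDiff_symmDiff_cancel_right _ _) (fun ω _ => symmDiff_symmDiff_cancel_right _ _)
      (fun ω _ => by rw [symmDiff_symmDiff_cancel_right])
  -- (3) the two nonnegative parts
  -- P-part: the `E₁`-functional of `Φ_θ = F(· ⊕ A_θ) + F(· ⊕ B_θ)`
  let Φ : Set (Sym2 V) → Set (Sym2 V) → ℝ := fun θ C => F (lift s a (A θ) C) + F (lift s a (B θ) C)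
  let Ψ : Set (Sym2 V) → Set (Sym2 V) → ℝ := fun θ C => G (lift s a (A θ) C) + G (lift s a (B θ) C)
  have hΦ : ∀ θ, Monotone (Φ θ) := fun θ C D hCD => add_le_add (hF (lift_mono_right s a _ hCD)) (hF (lift_mono_right s a _ hCD))
  have hΨ : ∀ θ, Monotone (Ψ θ) := fun θ C D hCD => add_le_add (hG (lift_mono_right s a _ hCD)) (hG (lift_mono_right s a _ hCD))
  let gP : Set (Sym2 V) → Set (Sym2 V) → ℝ := fun θ ω =>
    if θ ∈ Peel.tset E₂ a (R \ {a}) ∅ then (if ω ∈ Peel.tset E₁ s R X then Peel.delta (Φ θ) (Ψ θ) E₁ s ω else 0)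
    else (if ω ∈ Peel.tset E₁ s (insert a R) X then Peel.delta (Φ θ) (Ψ θ) E₁ s ω else 0)
  have hP : 0 ≤ ∑ ω, gP ω ω := by
    refine fiber_nonneg E₂ gP (fun θ ω D hD => ?_) (fun θ ω => ?_) (fun θ _ => ?_)
    · have hD' : ∀ e ∈ D, e ∉ E₁ := fun e he => hdis e (hD he)
      simp only [gP, mem_tset_congr E₁ s R X (symmDiff_inter_eq E₁ ω hD') (compl_symmDiff_inter_eq E₁ ω hD'),
        mem_tset_congr E₁ s (insert a R) X (symmDiff_inter_eq E₁ ω hD') (compl_symmDiff_inter_eq E₁ ω hD'),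
        delta_congr E₁ _ _ s (symmDiff_inter_eq E₁ ω hD') (compl_symmDiff_inter_eq E₁ ω hD')]
    · have e1 : θ ∩ E₂ = (θ ∩ E₂) ∩ E₂ := by rw [Set.inter_assoc, Set.inter_self]
      have e2 : θᶜ ∩ E₂ = (θ ∩ E₂)ᶜ ∩ E₂ := by
        rw [Set.compl_inter, Set.union_inter_distrib_right, Set.compl_inter_self, Set.union_empty]
      simp only [gP, Φ, Ψ, A, B, mem_tset_congr E₂ a (R \ {a}) ∅ e1 e2]
      rw [← e1, ← e2]
    · simp only [gP]
      split_ifs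
      · rw [← sum_mem_eq_sum_ite]; exact h₁ _ _ (hΦ θ) (hΨ θ)
      · rw [← sum_mem_eq_sum_ite]; exact h₁' _ _ (hΦ θ) (hΨ θ)
  -- Q-part: the four `E₂`-functionals of `u = F(x ⊕ ·), F(y ⊕ ·)`, `v = G(x ⊕ ·), G(y ⊕ ·)`
  let ux : Set (Sym2 V) → Set (Sym2 V) → ℝ := fun η S => F (lift s a S (x₀ η))
  let uy : Set (Sym2 V) → Set (Sym2 V) → ℝ := fun η S => F (lift s a S (y₀ η))
  let vx : Set (Sym2 V) → Set (Sym2 V) → ℝ := fun η S => G (lift s a S (x₀ η))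
  let vy : Set (Sym2 V) → Set (Sym2 V) → ℝ := fun η S => G (lift s a S (y₀ η))
  have hux : ∀ η, Monotone (ux η) := fun η S S' h => hF (lift_mono_left s a _ h)
  have huy : ∀ η, Monotone (uy η) := fun η S S' h => hF (lift_mono_left s a _ h)
  have hvx : ∀ η, Monotone (vx η) := fun η S S' h => hG (lift_mono_left s a _ h)
  have hvy : ∀ η, Monotone (vy η) := fun η S S' h => hG (lift_mono_left s a _ h)
  let Qs : Set (Sym2 V) → Set (Sym2 V) → ℝ := fun η ω =>
    (Peel.delta (ux η) (vx η) E₂ a ω + Peel.delta (ux η) (vy η) E₂ a ω) + (Peel.delta (uy η) (vx η) E₂ a ω + Peel.delta (uy η) (vy η) E₂ a ω)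
  let gQ : Set (Sym2 V) → Set (Sym2 V) → ℝ := fun η ω =>
    if η ∈ Peel.tset E₁ s R X ∧ ((openGraph (η ∩ E₁)).Reachable s a ∧ (openGraph (ηᶜ ∩ E₁)).Reachable s a) then
      (if ω ∈ Peel.tset E₂ a (R \ {a}) ∅ then Qs η ω else 0)
    else (if η ∈ Peel.tset E₁ s (insert a R) X then Qs η ω else 0)
  have hQ : 0 ≤ ∑ ω, gQ ω ω := by
    refine fiber_nonneg E₁ gQ (fun η ω D hD => ?_) (fun η ω => ?_) (fun η _ => ?_)
    · have hD' : ∀ e ∈ D, e ∉ E₂ := fun e he => hdis' e (hD he)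
      simp only [gQ, Qs, mem_tset_congr E₂ a (R \ {a}) ∅ (symmDiff_inter_eq E₂ ω hD') (compl_symmDiff_inter_eq E₂ ω hD'),
        delta_congr E₂ _ _ a (symmDiff_inter_eq E₂ ω hD') (compl_symmDiff_inter_eq E₂ ω hD')]
    · have e1 : η ∩ E₁ = (η ∩ E₁) ∩ E₁ := by rw [Set.inter_assoc, Set.inter_self]
      have e2 : ηᶜ ∩ E₁ = (η ∩ E₁)ᶜ ∩ E₁ := by
        rw [Set.compl_inter, Set.union_inter_distrib_right, Set.compl_inter_self, Set.union_empty]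
      simp only [gQ, Qs, ux, uy, vx, vy, x₀, y₀, mem_tset_congr E₁ s R X e1 e2, mem_tset_congr E₁ s (insert a R) X e1 e2]
      rw [← e1, ← e2]
    · simp only [gQ]
      have four : ∀ R' : Set V, (∀ u v : Set (Sym2 V) → ℝ, Monotone u → Monotone v → 0 ≤ Peel.tsum u v E₂ a R' ∅) →
          0 ≤ ∑ ω, if ω ∈ Peel.tset E₂ a R' ∅ then Qs η ω else 0 := by
        intro R' hgood
        rw [← sum_mem_eq_sum_ite]
        simp only [Qs, Finset.sum_add_distrib]
        exact add_nonneg (add_nonneg (hgood _ _ (hux η) (hvx η)) (hgood _ _ (hux η) (hvy η)))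
          (add_nonneg (hgood _ _ (huy η) (hvx η)) (hgood _ _ (huy η) (hvy η)))
      split_ifs
      · exact four _ h₂
      · have h0 := four ∅ h₂'
        have hset : Peel.tset E₂ a ∅ ∅ = Finset.univ := by ext ω; simp [Peel.mem_tset]
        simp only [hset, Finset.mem_univ, if_true] at h0
        exact h0
      · simp
  -- (4) pointwise identity on the constraint set and assembly
  have hpt : ∀ ω ∈ Peel.tset (E₁ ∪ E₂) s R X,
      Peel.delta F G (E₁ ∪ E₂) s ω + Peel.delta F G (E₁ ∪ E₂) s (ω ∆ E₂) = (1 / 2 : ℝ) * gP ω ω + (1 / 2 : ℝ) * gQ ω ω := by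
    intro ω hω
    have hω' := (mem_tset_union hsep hs R X hX ω).1 hω
    have hPω : gP ω ω = Peel.delta (Φ ω) (Ψ ω) E₁ s ω := by
      simp only [gP]
      split_ifs with hc hm hm'
      · rfl
      · exact absurd hω'.1 hm
      · rfl
      · exact absurd ((mem_tset_insert R X ω).2 ⟨hω'.1, fun hd => hc (hω'.2 hd)⟩) hm'
    have hQω : gQ ω ω = Qs ω ω := by
      simp only [gQ]
      split_ifs with hc hm hm'
      · rfl
      · exact absurd (hω'.2 hc.2) hm
      · rfl
      · refine absurd ((mem_tset_insert R X ω).2 ⟨hω'.1, fun hd => hc ⟨hω'.1, hd⟩⟩) hm'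
    rw [hPω, hQω, hΔ, hΔσ]
    exact glue_identity _ _ _ _ _ _ _ _
  have hsumP : ∑ ω ∈ Peel.tset (E₁ ∪ E₂) s R X, gP ω ω = ∑ ω, gP ω ω := by
    rw [sum_mem_eq_sum_ite]
    refine Finset.sum_congr rfl fun ω _ => ?_
    by_cases hω : ω ∈ Peel.tset (E₁ ∪ E₂) s R X
    · rw [if_pos hω]
    · rw [if_neg hω]
      simp only [gP]
      rw [mem_tset_union hsep hs R X hX] at hω
      split_ifs with hc hm hm'
      · exact absurd ⟨hm, fun _ => hc⟩ hω
      · rfl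
      · exact absurd ⟨((mem_tset_insert R X ω).1 hm').1, fun hd => absurd hd ((mem_tset_insert R X ω).1 hm').2⟩ hω
      · rfl
  have hsumQ : ∑ ω ∈ Peel.tset (E₁ ∪ E₂) s R X, gQ ω ω = ∑ ω, gQ ω ω := by
    rw [sum_mem_eq_sum_ite]
    refine Finset.sum_congr rfl fun ω _ => ?_
    by_cases hω : ω ∈ Peel.tset (E₁ ∪ E₂) s R X
    · rw [if_pos hω]
    · rw [if_neg hω]
      simp only [gQ]
      rw [mem_tset_union hsep hs R X hX] at hω
      split_ifs with hc hm hm'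
      · exact absurd ⟨hc.1, fun _ => hm⟩ hω
      · rfl
      · exact absurd ⟨((mem_tset_insert R X ω).1 hm').1, fun hd => absurd hd ((mem_tset_insert R X ω).1 hm').2⟩ hω
      · rfl
  have key : 2 * Peel.tsum F G (E₁ ∪ E₂) s R X = (1 / 2 : ℝ) * ∑ ω, gP ω ω + (1 / 2 : ℝ) * ∑ ω, gQ ω ω := by
    unfold Peel.tsum
    rw [two_mul]
    conv_lhs => arg 2; rw [hrefl]
    rw [← Finset.sum_add_distrib, Finset.sum_congr rfl hpt, Finset.sum_add_distrib, ← Finset.mul_sum, ← Finset.mul_sum, hsumP, hsumQ]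
  nlinarith [hP, hQ, key]

end Glue

end Antithetic

end Summit.CriticalPhenomena.PercolationContinuityZ3.Theorems
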